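import Summits.Ventures.PercRepro.LemmaBPlusCodes

/-!
# Bitmask connectivity for graphs on `Fin n` vertices and `Fin k` edges

p6's breadth-first `reach` is correct but goes through `Finset` machinery at every step, which
makes a row of the marked partition cost ≈ 0.3 s under kernel reduction.  Here the reach set is a
vertex MASK `s : ℕ` and one round adds the endpoints of every open edge touching the set with
accelerated `Nat` operations (`edgeMask`, `stepMask`, `reachMaskN`, `reachMask`); the bridge
`testBit_reachMaskN` identifies round `r` with p6's `reachN`, so `connM c x y = connD (cfgOf k c) x y`
(`connM_eq_connD`) and the row of a configuration code (`row4M`) is `row4Code` (`row4M_eq`).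
`rowTableM` / `facesCheckM` are the fast twins of `rowTable` / `facesCheck` (same values, `rowTableM_eq`,
`facesCheckM_eq`).
-/

namespace PercRepro

namespace MultiGraph

variable {n k : ℕ} (G : MultiGraph (Fin n) (Fin k))

/-! ### Masks -/

/-- The two endpoints of an edge as a vertex mask. -/
def edgeMask (e : Fin k) : ℕ := 2 ^ (G.fst e).val ||| 2 ^ (G.snd e).val

/-- A vertex is in the edge mask iff it is an endpoint. -/
theorem testBit_edgeMask (e : Fin k) (v : Fin n) :
    (G.edgeMask e).testBit v.val = (decide (G.fst e = v) || decide (G.snd e = v)) := by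
  simp only [edgeMask, Nat.testBit_or, Nat.testBit_two_pow, Fin.ext_iff]

/-- The mask meets the edge iff an endpoint is in the mask. -/
theorem land_edgeMask_ne_zero (s : ℕ) (e : Fin k) :
    s &&& G.edgeMask e ≠ 0 ↔
      s.testBit (G.fst e).val = true ∨ s.testBit (G.snd e).val = true := by
  constructor
  · intro h
    obtain ⟨i, hi⟩ := Nat.exists_testBit_of_ne_zero h
    rw [Nat.testBit_and, Bool.and_eq_true, edgeMask, Nat.testBit_or, Bool.or_eq_true,
      Nat.testBit_two_pow, Nat.testBit_two_pow, decide_eq_true_iff, decide_eq_true_iff] at hi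
    rcases hi with ⟨hs, rfl | rfl⟩
    · exact Or.inl hs
    · exact Or.inr hs
  · intro h hz
    rcases h with h | h
    · have := congrArg (fun x => x.testBit (G.fst e).val) hz
      simp [Nat.testBit_and, h, edgeMask, Nat.testBit_or, Nat.testBit_two_pow] at this
    · have := congrArg (fun x => x.testBit (G.snd e).val) hz
      simp [Nat.testBit_and, h, edgeMask, Nat.testBit_or, Nat.testBit_two_pow] at this

/-- One expansion round on masks: the endpoints of every open edge (`c.testBit e`) touching the
set are added. -/
def stepMask (c s : ℕ) : ℕ :=
  (List.finRange k).foldr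
    (fun e acc => (if c.testBit e.val = true ∧ s &&& G.edgeMask e ≠ 0 then G.edgeMask e else 0) ||| acc) s

/-- The bits of the fold: a vertex is added iff some listed open edge touching `s` has it as an
endpoint. -/
theorem testBit_foldr (c s : ℕ) (l : List (Fin k)) (v : Fin n) :
    (l.foldr (fun e acc =>
        (if c.testBit e.val = true ∧ s &&& G.edgeMask e ≠ 0 then G.edgeMask e else 0) ||| acc) s).testBit
      v.val = true ↔
      s.testBit v.val = true ∨ ∃ e ∈ l, c.testBit e.val = true ∧ s &&& G.edgeMask e ≠ 0 ∧
        (G.fst e = v ∨ G.snd e = v) := by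
  induction l with
  | nil => simp
  | cons e l ih =>
    rw [List.foldr_cons, Nat.testBit_or, Bool.or_eq_true, ih]
    constructor
    · rintro (h | h | h)
      · split_ifs at h with hc
        · right
          refine ⟨e, List.mem_cons_self, hc.1, hc.2, ?_⟩
          rw [testBit_edgeMask, Bool.or_eq_true, decide_eq_true_iff, decide_eq_true_iff] at h
          exact h
        · simp at h
      · exact Or.inl h
      · obtain ⟨e', he', h'⟩ := h
        exact Or.inr ⟨e', List.mem_cons_of_mem _ he', h'⟩
    · rintro (h | ⟨e', he', h1, h2, h3⟩)
      · exact Or.inr (Or.inl h)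
      · rcases List.mem_cons.mp he' with rfl | he'
        · left
          rw [if_pos ⟨h1, h2⟩, testBit_edgeMask, Bool.or_eq_true, decide_eq_true_iff,
            decide_eq_true_iff]
          exact h3
        · exact Or.inr (Or.inr ⟨e', he', h1, h2, h3⟩)

/-- `r` rounds from the vertex `x`. -/
def reachMaskN (c : ℕ) (x : Fin n) : ℕ → ℕ
  | 0 => 2 ^ x.val
  | r + 1 => G.stepMask c (reachMaskN c x r)

/-- **Round `r` on masks is round `r` of p6's `reachN`** on the configuration `cfgOf k c`. -/
theorem testBit_reachMaskN (c : ℕ) (x : Fin n) (r : ℕ) (v : Fin n) :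
    (G.reachMaskN c x r).testBit v.val = true ↔ v ∈ G.reachN (cfgOf k c) x r := by
  induction r generalizing v with
  | zero =>
    rw [reachMaskN, reachN_zero, Finset.mem_singleton, Nat.testBit_two_pow, decide_eq_true_iff,
      Fin.ext_iff]
    exact eq_comm
  | succ r ih =>
    rw [reachMaskN, reachN_succ, mem_expand, stepMask, testBit_foldr, ih]
    constructor
    · rintro (h | ⟨e, _, hc, hs, hv⟩)
      · exact Or.inl h
      · rw [land_edgeMask_ne_zero, ih, ih] at hs
        rcases hv with rfl | rfl
        · rcases hs with hs | hs
          · exact Or.inl hs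
          · exact Or.inr ⟨G.snd e, hs, e, hc, Or.inr ⟨rfl, rfl⟩⟩
        · rcases hs with hs | hs
          · exact Or.inr ⟨G.fst e, hs, e, hc, Or.inl ⟨rfl, rfl⟩⟩
          · exact Or.inl hs
    · rintro (h | ⟨u, hu, e, hc, hend⟩)
      · exact Or.inl h
      · right
        refine ⟨e, List.mem_finRange e, hc, ?_, ?_⟩
        · rw [land_edgeMask_ne_zero, ih, ih]
          rcases hend with ⟨rfl, _⟩ | ⟨_, rfl⟩
          · exact Or.inl hu
          · exact Or.inr hu
        · rcases hend with ⟨_, rfl⟩ | ⟨rfl, _⟩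
          · exact Or.inr rfl
          · exact Or.inl rfl

/-- The reach mask of `x`: `n` rounds (the number of vertices). -/
def reachMask (c : ℕ) (x : Fin n) : ℕ := G.reachMaskN c x n

/-- Mask connectivity. -/
def connM (c : ℕ) (x y : Fin n) : Bool := (G.reachMask c x).testBit y.val

/-- **Mask connectivity is p6's `connD`** on the configuration `cfgOf k c`. -/
theorem connM_eq_connD (c : ℕ) (x y : Fin n) : G.connM c x y = G.connD (cfgOf k c) x y := by
  unfold connM connD reach reachMask
  rw [Bool.eq_iff_iff, decide_eq_true_iff, Fintype.card_fin]
  exact G.testBit_reachMaskN c x n y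

/-! ### Fast rows and tables -/

/-- The six connection atoms of a configuration code, packed (mask connectivity). -/
def atomsM (m : Fin 4 → Fin n) (c : ℕ) : ℕ :=
  ∑ a : Fin 6, if G.connM c (m (pair4 a).1) (m (pair4 a).2) then 2 ^ a.val else 0

/-- The fast atoms are the atoms of `cfgOf k c`. -/
theorem atomsM_eq (m : Fin 4 → Fin n) (c : ℕ) : G.atomsM m c = G.atomsCode m (cfgOf k c) := by
  unfold atomsM atomsCode
  refine Finset.sum_congr rfl fun a _ => ?_
  rw [connM_eq_connD]

/-- The fast row of a configuration code. -/
def row4M (m : Fin 4 → Fin n) (c : ℕ) : ℕ :=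
  withLit (G.atomsM m c) fun a => (rowOf4 fun a' => a.testBit a'.val).val

/-- The fast row is `row4Code`. -/
theorem row4M_eq (m : Fin 4 → Fin n) (c : ℕ) : G.row4M m c = G.row4Code m (cfgOf k c) := by
  unfold row4M row4Code
  rw [atomsM_eq]

/-- The fast rows as `Fin 16` digits. -/
def rowDigitM (m : Fin 4 → Fin n) (c : Fin (2 ^ k)) : Fin 16 :=
  ⟨G.row4M m c.val, by rw [row4M_eq]; exact (G.rowDigit m c).isLt⟩

/-- The fast row table. -/
def rowTableM (m : Fin 4 → Fin n) : ℕ := (finFunctionFinEquiv (G.rowDigitM m)).val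

/-- The fast table is the row table. -/
theorem rowTableM_eq (m : Fin 4 → Fin n) : G.rowTableM m = G.rowTable m := by
  unfold rowTableM rowTable
  congr 2
  funext c
  exact Fin.ext (G.row4M_eq m c.val)

/-- The fast face check (all faces). -/
def facesCheckM (m : Fin 4 → Fin n) : Bool :=
  withLitB (G.rowTableM m) fun T =>
    decide (∀ u v : Fin (2 ^ k), v.val &&& u.val = v.val →
      faceSizeM k u.val v.val ≤ faceScoreT k T u.val v.val)

/-- The fast check is `facesCheck`. -/
theorem facesCheckM_eq (m : Fin 4 → Fin n) : G.facesCheckM m = G.facesCheck m := by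
  unfold facesCheckM facesCheck
  rw [rowTableM_eq]

/-- Lemma B⁺ on every face of `G` from the fast check. -/
theorem facesBPlus_of_facesCheckM (m : Fin 4 → Fin n) (h : G.facesCheckM m = true) :
    G.FacesBPlus m :=
  G.facesBPlus_of_facesCheck m (by rwa [facesCheckM_eq] at h)

end MultiGraph

end PercRepro
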